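import Summits.BirchSwinnertonDyer.BirchSwinnertonDyer.Theorems.PrintX8VerticalStevensCollapse
import Summits.BirchSwinnertonDyer.BirchSwinnertonDyer.Theorems.PrintX8SharpFlatMuDefect
import Summits.BirchSwinnertonDyer.BirchSwinnertonDyer.Theses.PrintX8
import HarnessLib

/-!
# Route `PrintX8`, crux `MuBoundSmallImageX8` (stmt-BirchSwinnertonDyer-20622): the VERTICAL-STEVENS road
# to the crux BY NAME — VS-1 «the cyclotomic winding symbol is non-constant mod 3 on every small-image X8
# pair» + the two held inputs of item 20771 ⟹ `Theses.PrintX8.MuBoundSmallImageX8`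
# (cell `bsd-print-x8`, D-0131 (2) print tier, prover seat p3 g3; `--supports` 20622, closes nothing)

PARTITION (cell bsd-print-x8, leaf `ClassX8`): a BY-NAME CLOSER ROAD of crux 20622 (planner ruling PLAN
v1.8b §2: LINE «vertical Stevens at 3» stays a closer road `--supports 20622`, no items, while the
active decomposition An 20714 + 20771 + glue 20716 is open and unrefuted).  Closes NO item (VS-1 is an
OPEN hypothesis here, exactly as An is in the An road), moves 0 census cells; BSD is not proved by any of
this.  beyond-print: yes (modest; the content is part 2's `p = 3` collapse).

THE ROAD (planner memo `run/shared/lean/pub/bsd-print-x8/plan/vs/LINE-VERTICAL-STEVENS-AT-3.md`, plan g4;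
`SketchVS.lean` §3 `VS.muBoundSmallImageX8_of_cycWinding` had this composition kernel-checked MODULO the
support VS-G, which parts 1–2 `PrintX8MazurTateThreeCollapse` / `PrintX8VerticalStevensCollapse` now PROVE):

  VS-1 `CycWindingNonConstantSmallImageX8` (item spelling of `plan/vs/resplit-VS-children.json` child 1,
  VERBATIM; class-wide, image-free in mechanism, K1-free, no Conjecture A; implied by EIS-SPAN(N_E, 3) —
  group theory of `Γ₀(N)` — via the Hecke–Eisenstein step `a_3 ≢ 1 (mod 3)`, memo §3–§4; kit j286420:
  CONJ-SPAN(N,3) at all 190 levels `N ≤ 300`)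
    ⟹ (part 2, `oneColourMuAn_of_cycWindingNonConstantSmallImageX8`: the `p = 3` collapse)
  the ONE-colour analytic rider `hμ1`
    ⟹ (the ONE-colour Euler-system `μ`-transfer `X8.sharpFlatMu_le_of_oneColour_hasUnitContent` of
       `PrintX8SharpFlatMuDefect` — the argument of p548147's `muBoundSmallImageX8_of_oneColour_sharpFlatMuAn`,
       inlined here so that this module imports only the route file and route-independent modules
       (theses-cone hygiene) — modulo the held facts `Sprung2012.thm714seq_sharpFlatColemanKato_zeta` =
       item 20772 and the period unit at `3` = `InputPeriodUnitThree`, i.e. the input item 20771)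
  `Theses.PrintX8.MuBoundSmallImageX8` (item 20622) BY NAME.

`muBoundSmallImageX8_of_cycWindingNonConstantSmallImageX8` takes `(hCK) (h3) (hVS)`;
`muBoundSmallImageX8_of_inputSharpFlatMuTransfer_of_cycWinding` takes the route's input item 20771 by name;
`muBoundSmallImageX8_of_cycWindingNonConstantX8` takes the image-free form VS-1⁺.  If the planner ever
resplits 20622 into VS-1 + VS-G + `InputSharpFlatMuTransferVS` (TRIGGER (a) of PLAN v1.8b), the generated
glue is closed by the first theorem in one line.  What it does NOT reach: item 20714 An (both colours).

References: [Pollack2003] Def. 6.15; [Sprung2017] Cor. 4.10, Thm. 1.12; [Sprung2012] Def. 6.1, Thm. 7.14,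
Prop. 7.19; [Kato2004Asterisque] Thm. 12.6; [PerrinRiou2003] §7.1 Conj. 7.1; [Stevens1985] §3;
files `Theses/PrintX8.lean` (rev 17), `Theorems/PrintX8SharpFlatMuDefect.lean` (one-colour transfer),
`Theorems/PrintX8SharpFlatMuBoundGlue.lean` (p548147, same argument), `Theorems/PrintX8VerticalStevensCollapse.lean`
(part 2, p559770), planner memo + `SketchVS.lean` (plan g4).
-/

set_option autoImplicit false
-- justification: the mandated namespace `Summit.BirchSwinnertonDyer.BirchSwinnertonDyer.Theorems`
-- (single-conjunct summit, Sub = Summit) repeats a segment by design (D-0017).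
set_option linter.dupNamespace false

noncomputable section

open scoped Classical NumberField MatrixGroups ModularForm

open NumberField IsDedekindDomain WeierstrassCurve CongruenceSubgroup Field
  Literature.NumberTheory.EllipticCurves Literature.NumberTheory.EllipticCurves.ModularForms
  Literature.NumberTheory.EllipticCurves.Rank1Residual
  Literature.NumberTheory.EllipticCurves.Sprung2017 Literature.NumberTheory.EllipticCurves.Sprung2012
  Literature.NumberTheory.EllipticCurves.GreenbergVatsal2000
  Literature.NumberTheory.EllipticCurves.ZpExtension Literature.NumberTheory.EllipticCurves.IwasawaAlgebra
  Summit.BirchSwinnertonDyer.BirchSwinnertonDyer.Theorems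
  Summit.BirchSwinnertonDyer.BirchSwinnertonDyer.Theorems.PrintX8SharpFlatMuTransfer
  Summit.BirchSwinnertonDyer.BirchSwinnertonDyer.Theorems.PrintX8VerticalStevensCollapse

namespace Summit.BirchSwinnertonDyer.BirchSwinnertonDyer.Theorems.PrintX8VerticalStevens

/-- **Crux 20622 `MuBoundSmallImageX8` from VS-1, BY NAME.**  Hypotheses: `hCK` = Sprung 2012's ♯/♭
Coleman–Kato package (item 20772, held fact), `h3` = the period unit at `3` (`InputPeriodUnitThree`, held
fact), `hVS` = VS-1 `CycWindingNonConstantSmallImageX8` VERBATIM (on every X8 pair with `ρ̄_{E,3}` not onto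
the winding symbol of the newform is non-constant modulo `3` on `ℤ[1/3]`).  Proof: part 2's `p = 3`
collapse gives ONE colour `col₀` with unit content at the pair; a period ratio for `f` comes from `h3`; the
one-colour Euler-system `μ`-transfer `X8.sharpFlatMu_le_of_oneColour_hasUnitContent` (route-independent;
the body of p548147's closer) bounds `μ(X^•)` for EVERY colour.  NO K1, no Galois-image input beyond
«not onto», no Conjecture A, no both-colour rider. [cite: Pollack2003, Def. 6.15] [cite: Sprung2017, Cor. 4.10 and Thm. 1.12]
[cite: Sprung2012, Def. 6.1, Thm. 7.14 and Prop. 7.19] -/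
theorem muBoundSmallImageX8_of_cycWindingNonConstantSmallImageX8
    (hCK : thm714seq_sharpFlatColemanKato_zeta) (h3 : realPeriodRat_eq_unit_mul_plusPeriod_three)
    (hVS : ∀ (W : WeierstrassCurve ℚ) [W.IsElliptic] [W.IsGloballyMinimal] (p : ℕ) [Fact p.Prime],
      ClassX8 W p → ¬ Surj W p → ∀ (N : ℕ) (_ : NeZero N) (f : CuspForm (Gamma0 N) 2),
        IsNewformOf W f → ∃ (n : ℕ) (a a' : ℤ), 1 ≤ ‖((ratPlusSymbol f ((a : ℚ) / (p : ℚ) ^ n) -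
          ratPlusSymbol f ((a' : ℚ) / (p : ℚ) ^ n) : ℚ) : ℚ_[p])‖) :
    Theses.PrintX8.MuBoundSmallImageX8 := by
  intro W _ _ p _ hX hns _hr col κ γ hκ hγ hγ' v hv g hg cneg c hH N hN f Lsharp Lflat hf hSP hcol D
  haveI := hN
  -- the `p = 3` collapse (part 2): ONE colour `col₀` with unit content, from VS-1 at the pair
  obtain ⟨col₀, hu₀⟩ :=
    ClassX8.exists_hasUnitContent_chromaticL_of_cycWindingNonConstant hX hf hSP (hVS W p hX hns N hN f hf)
  -- a period ratio for `f` from the period fact at `3` (as in p548147)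
  have hp3 : p = 3 := hX.1
  subst hp3
  obtain ⟨u, hu1, hΩ⟩ := h3 W hX.2.1.1 (ClassX8.irr W 3 hX) f hf
  have hu0 : (u : ℝ) ≠ 0 := by
    intro h
    have h0 : u = 0 := by exact_mod_cast h
    rw [h0] at hu1
    simp at hu1
  have hϖ : ((u⁻¹ : ℚ) : ℝ) * W.realPeriodRat = plusPeriod f := by
    rw [hΩ, Rat.cast_inv, ← mul_assoc, inv_mul_cancel₀ hu0, one_mul]
  -- the Euler-system `μ`-transfer from ONE colour to every colour (p546801, route-independent)
  exact X8.sharpFlatMu_le_of_oneColour_hasUnitContent W 3 hCK h3 hX hns f hf u⁻¹ hϖ κ γ hκ hγ hγ' v hv g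
    hg cneg c hH hSP col₀ hu₀ col hcol D

/-- **Crux 20622 from VS-1 and the route's input item 20771 `InputSharpFlatMuTransfer` BY NAME** (the
shape of the glue the gate would generate on a resplit `MuBoundSmallImageX8 ⟸ VS-1 + VS-G +
InputSharpFlatMuTransfer`, with VS-G discharged). [cite: Pollack2003, Def. 6.15] [cite: Sprung2012, Thm. 7.14 and Prop. 7.19] -/
theorem muBoundSmallImageX8_of_inputSharpFlatMuTransfer_of_cycWinding
    (hIn : Theses.PrintX8.InputSharpFlatMuTransfer)
    (hVS : ∀ (W : WeierstrassCurve ℚ) [W.IsElliptic] [W.IsGloballyMinimal] (p : ℕ) [Fact p.Prime],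
      ClassX8 W p → ¬ Surj W p → ∀ (N : ℕ) (_ : NeZero N) (f : CuspForm (Gamma0 N) 2),
        IsNewformOf W f → ∃ (n : ℕ) (a a' : ℤ), 1 ≤ ‖((ratPlusSymbol f ((a : ℚ) / (p : ℚ) ^ n) -
          ratPlusSymbol f ((a' : ℚ) / (p : ℚ) ^ n) : ℚ) : ℚ_[p])‖) :
    Theses.PrintX8.MuBoundSmallImageX8 :=
  muBoundSmallImageX8_of_cycWindingNonConstantSmallImageX8 hIn.1 hIn.2 hVS

/-- **Crux 20622 from the image-free form VS-1⁺** `CycWindingNonConstantX8` (non-constant winding symbol on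
ALL X8 pairs; the natural output of EIS-SPAN(N,3) + the Hecke–Eisenstein step, which never sees the
`3`-adic image). [cite: Pollack2003, Def. 6.15] [cite: Sprung2012, Thm. 7.14 and Prop. 7.19] -/
theorem muBoundSmallImageX8_of_cycWindingNonConstantX8
    (hCK : thm714seq_sharpFlatColemanKato_zeta) (h3 : realPeriodRat_eq_unit_mul_plusPeriod_three)
    (hVS : ∀ (W : WeierstrassCurve ℚ) [W.IsElliptic] [W.IsGloballyMinimal] (p : ℕ) [Fact p.Prime],
      ClassX8 W p → ∀ (N : ℕ) (_ : NeZero N) (f : CuspForm (Gamma0 N) 2),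
        IsNewformOf W f → ∃ (n : ℕ) (a a' : ℤ), 1 ≤ ‖((ratPlusSymbol f ((a : ℚ) / (p : ℚ) ^ n) -
          ratPlusSymbol f ((a' : ℚ) / (p : ℚ) ^ n) : ℚ) : ℚ_[p])‖) :
    Theses.PrintX8.MuBoundSmallImageX8 :=
  muBoundSmallImageX8_of_cycWindingNonConstantSmallImageX8 hCK h3
    fun W _ _ p _ hX _ N hN f hf ↦ hVS W p hX N hN f hf

end Summit.BirchSwinnertonDyer.BirchSwinnertonDyer.Theorems.PrintX8VerticalStevens

end
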